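import Literature.NumberTheory.Sieve.SmoothZetaDecayResonance
import Literature.NumberTheory.Sieve.SmoothZetaDecayNearAxisSaddle
import Literature.NumberTheory.Sieve.SmoothSaddlePointUniformUpper
import Literature.NumberTheory.LFunctions.MertensElementary
import HarnessLib

/-!
# Preparations for the saddle-point evaluation of `Ψ(x, y)` in the range `y < 8 (log x)³`

Topic `Literature/NumberTheory/Sieve`; a PROVED tool file toward `Literature.NumberTheory.Sieve.HTLocalBehaviour`
[HildebrandTenenbaum1986, Thm 3]. With `α = α(x, y)`, `L = log y`:

* `min_sqrt_le_rpow_one_sub_saddlePoint` — `y^{1-α} ≥ min(√y, log x/(9 log y))` (saddle-point equation and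
  Mertens' bound `Σ_{p ≤ y} log p/p ≤ log y + log 4`);
* `saddlePoint_le_one_of_lt_log` — `α ≤ 1` as soon as `2(log y + log 4) < log x`;
* `exists_nearAxis_params` — in both regimes `α log y ≶ 1` the near-axis bound has the shape
  `|ζ(α+it, y)| ≤ ζ(α, y)(1 + a t²)^{-K/2}` (`|t| ≤ π/log y`) with `aK = 4φ₂(α,y)/π²` and `K ≥ 17 log y`;
* `exists_norm_smoothZetaC_le_exp_neg_mid` — for `π/log y ≤ |t| ≤ y/(100 log y)` and `0 < σ ≤ 1`,
  `|ζ(σ+it, y)| ≤ ζ(σ, y) exp(-c y^{1-σ}/log⁵ y)` (`SmoothZetaDecayResonance`);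
* two numerical lemmas (`rpow_neg_quarter_le_exp`, `sqrt_le_two_rpow_div_eight`).

## References

* [HildebrandTenenbaum1986] A. Hildebrand, G. Tenenbaum, Trans. AMS 296 (1986) 265–290, Lemmas 2, 4, 8.
-/

noncomputable section

open Complex Real Finset

namespace Literature.NumberTheory.Sieve

namespace RegimeB

/-! ### `y^{1-α}` from below, `α ≤ 1` -/

/-- `2^{-1/2} ≤ 0.7072`. [folklore] -/
theorem two_rpow_neg_half_le : (2 : ℝ) ^ (-(1 / 2 : ℝ)) ≤ 0.7072 := by
  rw [Real.rpow_neg (by norm_num : (0 : ℝ) ≤ 2), ← Real.sqrt_eq_rpow]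
  rw [inv_le_comm₀ (Real.sqrt_pos.2 (by norm_num)) (by norm_num)]
  rw [Real.le_sqrt (by norm_num)]
  all_goals norm_num

/-- **`y^{1-α} ≥ min(√y, log x/(9 log y))`** for `x > 1`, `y ≥ 3` and `α = α(x,y) ≤ 1`: either `α ≤ 1/2`, or
`p^α - 1 ≥ (1 - 2^{-1/2}) p^α` for every prime, so that the saddle-point equation gives
`log x = Σ log p/(p^α - 1) ≤ 3.42 y^{1-α} Σ_{p ≤ y} log p/p ≤ 3.42 (log y + log 4) y^{1-α}`.
[cite: HildebrandTenenbaum1986, Lemma 2 (3.3)] -/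
theorem min_sqrt_le_rpow_one_sub_saddlePoint {x : ℝ} {y : ℕ} (hx : 1 < x) (hy : 3 ≤ y)
    (hα1 : saddlePoint x y ≤ 1) :
    min (Real.sqrt y) (Real.log x / (9 * Real.log y)) ≤ (y : ℝ) ^ (1 - saddlePoint x y) := by
  have hy2 : 2 ≤ y := le_trans (by norm_num) hy
  set α : ℝ := saddlePoint x y with hα
  have hy0 : (0 : ℝ) < y := by positivity
  have hy1 : (1 : ℝ) ≤ y := by exact_mod_cast le_trans (by norm_num) hy
  have hy3 : (3 : ℝ) ≤ y := by exact_mod_cast hy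
  have hL1 : 1 ≤ Real.log y := by
    rw [Real.le_log_iff_exp_le hy0]
    exact le_trans Real.exp_one_lt_d9.le (by linarith)
  have hL0 : 0 < Real.log y := by linarith
  rcases le_or_gt α (1 / 2) with hαhalf | hαhalf
  · refine (min_le_left _ _).trans ?_
    rw [Real.sqrt_eq_rpow]
    exact Real.rpow_le_rpow_of_exponent_le hy1 (by linarith)
  · refine (min_le_right _ _).trans ?_
    have heq := saddleSum_saddlePoint hx hy2
    rw [← hα, saddleSum] at heq
    set E : ℝ := (y : ℝ) ^ (1 - α) with hE
    have hE0 : 0 < E := Real.rpow_pos_of_pos hy0 _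
    have hterm : ∀ p ∈ Nat.primesLE y, Real.log p / ((p : ℝ) ^ α - 1) ≤ 3.42 * E * (Real.log p / p) := by
      intro p hp
      obtain ⟨hple, hpp⟩ := Nat.mem_primesLE.1 hp
      have hp2 : (2 : ℝ) ≤ p := by exact_mod_cast hpp.two_le
      have hp0 : (0 : ℝ) < p := by linarith
      have hpy : (p : ℝ) ≤ y := by exact_mod_cast hple
      have hlogp0 : 0 ≤ Real.log p := Real.log_nonneg (by linarith)
      have hpα0 : 0 < (p : ℝ) ^ α := Real.rpow_pos_of_pos hp0 α
      have hpinv : (p : ℝ) ^ (-α) ≤ 0.7072 := by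
        calc (p : ℝ) ^ (-α) ≤ (2 : ℝ) ^ (-α) := Real.rpow_le_rpow_of_nonpos (by norm_num) hp2 (by linarith)
          _ ≤ (2 : ℝ) ^ (-(1 / 2 : ℝ)) := Real.rpow_le_rpow_of_exponent_le (by norm_num) (by linarith)
          _ ≤ 0.7072 := two_rpow_neg_half_le
      have hinvmul : (p : ℝ) ^ (-α) * (p : ℝ) ^ α = 1 := by
        rw [← Real.rpow_add hp0, neg_add_cancel, Real.rpow_zero]
      have hden : 0.2928 * (p : ℝ) ^ α ≤ (p : ℝ) ^ α - 1 := by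
        nlinarith [mul_le_mul_of_nonneg_right hpinv hpα0.le]
      have hden0 : 0 < (p : ℝ) ^ α - 1 := by nlinarith
      have hp1α : (p : ℝ) ^ (1 - α) ≤ E := Real.rpow_le_rpow hp0.le hpy (by linarith)
      have hsplit : (p : ℝ) ^ (1 - α) = p * (p : ℝ) ^ (-α) := by
        rw [sub_eq_add_neg, Real.rpow_add hp0, Real.rpow_one]
      calc Real.log p / ((p : ℝ) ^ α - 1) ≤ Real.log p / (0.2928 * (p : ℝ) ^ α) :=
            div_le_div_of_nonneg_left hlogp0 (by positivity) hden
        _ = (1 / 0.2928) * ((p : ℝ) ^ (1 - α)) * (Real.log p / p) := by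
            rw [hsplit]
            field_simp
            rw [mul_assoc, mul_comm ((p : ℝ) ^ α), hinvmul, mul_one]
        _ ≤ 3.42 * E * (Real.log p / p) := by
            have h1 : (1 / 0.2928 : ℝ) ≤ 3.42 := by norm_num
            have h2 : 0 ≤ Real.log p / p := by positivity
            have := mul_le_mul h1 hp1α (Real.rpow_nonneg hp0.le _) (by norm_num)
            exact mul_le_mul_of_nonneg_right this h2
    have hsum : Real.log x ≤ 3.42 * E * (Real.log y + Real.log 4) := by
      rw [← heq]
      calc ∑ p ∈ Nat.primesLE y, Real.log p / ((p : ℝ) ^ α - 1)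
          ≤ ∑ p ∈ Nat.primesLE y, 3.42 * E * (Real.log p / p) := Finset.sum_le_sum hterm
        _ = 3.42 * E * ∑ p ∈ Nat.primesLE y, Real.log p / p := by rw [Finset.mul_sum]
        _ ≤ 3.42 * E * (Real.log y + Real.log 4) :=
            mul_le_mul_of_nonneg_left (LFunctions.MertensBound.sum_log_div_prime_le y) (by positivity)
    rw [div_le_iff₀ (by positivity)]
    have hl4 := log_four_le
    nlinarith [hsum, hE0, hL1]

/-- **`α(x, y) ≤ 1` once `log x > 2(log y + log 4)`**: `Σ log p/(p^σ - 1)` decreases in `σ`, and at `σ = 1` it is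
`Σ_{p ≤ y} log p/(p - 1) ≤ 2 Σ log p/p ≤ 2(log y + log 4)`. [cite: HildebrandTenenbaum1986, Lemma 2 (3.3)] -/
theorem saddlePoint_le_one_of_lt_log {x : ℝ} {y : ℕ} (hx : 1 < x) (hy : 2 ≤ y)
    (h : 2 * (Real.log y + Real.log 4) < Real.log x) : saddlePoint x y ≤ 1 := by
  by_contra hα
  push Not at hα
  have hα0 : 0 < saddlePoint x y := saddlePoint_pos hx hy
  have hlt := (saddleSum_strictAntiOn hy) (Set.mem_Ioi.2 zero_lt_one) (Set.mem_Ioi.2 hα0) hα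
  simp only at hlt
  rw [saddleSum_saddlePoint hx hy] at hlt
  have h1 : saddleSum 1 y ≤ 2 * (Real.log y + Real.log 4) := by
    rw [saddleSum]
    calc ∑ p ∈ Nat.primesLE y, Real.log p / ((p : ℝ) ^ (1 : ℝ) - 1)
        ≤ ∑ p ∈ Nat.primesLE y, 2 * (Real.log p / p) := by
          refine Finset.sum_le_sum fun p hp => ?_
          obtain ⟨-, hpp⟩ := Nat.mem_primesLE.1 hp
          have hp2 : (2 : ℝ) ≤ p := by exact_mod_cast hpp.two_le
          have hlogp0 : 0 ≤ Real.log p := Real.log_nonneg (by linarith)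
          rw [Real.rpow_one]
          rw [show 2 * (Real.log p / p) = Real.log p / (p / 2) by field_simp]
          exact div_le_div_of_nonneg_left hlogp0 (by linarith) (by linarith)
      _ = 2 * ∑ p ∈ Nat.primesLE y, Real.log p / p := by rw [Finset.mul_sum]
      _ ≤ 2 * (Real.log y + Real.log 4) :=
          mul_le_mul_of_nonneg_left (LFunctions.MertensBound.sum_log_div_prime_le y) (by norm_num)
  linarith

/-! ### The near-axis bound in the two regimes -/

/-- **Near-axis parameters.** For `y ≥ y₀`, `x ≥ y` and `φ₂(α, y) ≥ 340 log³ y` there are `a > 0` and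
`K ≥ 17 log y` with `aK = 4φ₂(α, y)/π²` and `|ζ(α+it, y)| ≤ ζ(α, y)(1 + a t²)^{-K/2}` for `|t| ≤ π/log y`:
if `α log y ≤ 1` take `a = 108 φ₂/(π² π(y))`, `K = π(y)/27` (`norm_smoothZetaC_le_mul_rpow_of_mul_log_le_one`,
`π(y) ≥ y/(4 log y) ≥ 459 log y`), otherwise `a = 80 log² y/π²`, `K = φ₂/(20 log² y)`
(`norm_smoothZetaC_le_mul_rpow_of_one_le_mul_log`). [cite: HildebrandTenenbaum1986, §3 Lemma 8 (i), (3.15)] -/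
theorem exists_nearAxis_params :
    ∃ y₀ : ℕ, ∀ (x : ℝ) (y : ℕ), y₀ ≤ y → (y : ℝ) ≤ x →
      340 * Real.log y ^ 3 ≤ saddlePhi₂ (saddlePoint x y) y →
      ∃ a K : ℝ, 0 < a ∧ 17 * Real.log y ≤ K ∧ a * K = 4 * saddlePhi₂ (saddlePoint x y) y / Real.pi ^ 2 ∧
        ∀ t : ℝ, |t| ≤ Real.pi / Real.log y →
          ‖smoothZetaC ((saddlePoint x y : ℂ) + t * I) y‖ ≤
            smoothZeta (saddlePoint x y) y * (1 + a * t ^ 2) ^ (-(K / 2)) := by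
  obtain ⟨y₁, hy₁2, hk⟩ := exists_card_primesLE_ge
  obtain ⟨Y₁, -, hY₁⟩ := exists_log_le_mul_rpow (κ := 1 / 1836) (ε := 1 / 2) (by norm_num) (by norm_num)
  refine ⟨max (max y₁ 3) ⌈Y₁⌉₊, fun x y hy hyx hφlo => ?_⟩
  have hy₁ : y₁ ≤ y := le_trans (le_max_left _ _) (le_trans (le_max_left _ _) hy)
  have hy3 : 3 ≤ y := le_trans (le_max_right _ _) (le_trans (le_max_left _ _) hy)
  have hyY₁ : Y₁ ≤ y := le_trans (Nat.le_ceil Y₁) (by exact_mod_cast le_trans (le_max_right _ _) hy)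
  have hy2 : 2 ≤ y := le_trans (by norm_num) hy3
  have hy0 : (0 : ℝ) < y := by positivity
  have hy3r : (3 : ℝ) ≤ y := by exact_mod_cast hy3
  have hx : 1 < x := lt_of_lt_of_le (by linarith) hyx
  set α : ℝ := saddlePoint x y with hα
  have hα0 : 0 < α := saddlePoint_pos hx hy2
  set L : ℝ := Real.log y with hL
  have hL1 : 1 ≤ L := by
    rw [hL, Real.le_log_iff_exp_le hy0]; exact le_trans Real.exp_one_lt_d9.le (by linarith)
  have hL0 : 0 < L := by linarith
  set φ : ℝ := saddlePhi₂ α y with hφ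
  have hφ0 : 0 < φ := saddlePhi₂_pos hy2 hα0
  have hπ := Real.pi_pos
  rcases le_or_gt (α * L) 1 with hαL | hαL
  · -- `α log y ≤ 1`: `a = 108 φ/(π² k)`, `K = k/27`
    set k : ℝ := (#(Nat.primesLE y) : ℝ) with hk'
    have hklo : (y : ℝ) / (4 * L) ≤ k := hk y hy₁
    have hkL : 459 * L ≤ k := by
      -- `log y ≤ y^{1/2}/1836`, so `459 L · 4 L ≤ y`
      have h1 : L ≤ 1 / 1836 * (y : ℝ) ^ (1 / 2 : ℝ) := hY₁ y hyY₁
      have h2 : L ^ 2 ≤ (1 / 1836) ^ 2 * y := by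
        have h3 := pow_le_pow_left₀ hL0.le h1 2
        have hsq : ((y : ℝ) ^ (1 / 2 : ℝ)) ^ 2 = y := by
          rw [← Real.rpow_natCast, ← Real.rpow_mul hy0.le]; norm_num
        rw [mul_pow, hsq] at h3
        exact h3
      refine le_trans ?_ hklo
      rw [le_div_iff₀ (by positivity)]
      nlinarith
    have hk0 : 0 < k := by linarith
    refine ⟨108 * φ / (Real.pi ^ 2 * k), k / 27, by positivity, by linarith, ?_, fun t ht => ?_⟩
    · field_simp; ring
    · have h := norm_smoothZetaC_le_mul_rpow_of_mul_log_le_one (t := t) hα0 hy2 hαL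
        (by rw [le_div_iff₀ hL0] at ht; exact ht)
      have e1 : 1 + 108 * t ^ 2 * saddlePhi₂ α y / (Real.pi ^ 2 * #(Nat.primesLE y)) =
          1 + 108 * φ / (Real.pi ^ 2 * k) * t ^ 2 := by rw [hk', hφ]; ring
      have e2 : -((#(Nat.primesLE y) : ℝ) / 54) = -(k / 27 / 2) := by rw [hk']; ring
      rw [e1, e2] at h
      exact h
  · -- `α log y > 1`: `a = 80 L²/π²`, `K = φ/(20 L²)`
    refine ⟨80 * L ^ 2 / Real.pi ^ 2, φ / (20 * L ^ 2), by positivity, ?_, ?_, fun t ht => ?_⟩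
    · rw [le_div_iff₀ (by positivity)]
      calc 17 * L * (20 * L ^ 2) = 340 * Real.log y ^ 3 := by rw [hL]; ring
        _ ≤ φ := hφlo
    · field_simp; ring
    · have h := norm_smoothZetaC_le_mul_rpow_of_one_le_mul_log (t := t) hα0 hy2 hαL.le
        (by rw [le_div_iff₀ hL0] at ht; exact ht)
      have e1 : 1 + 80 * t ^ 2 * Real.log y ^ 2 / Real.pi ^ 2 = 1 + 80 * L ^ 2 / Real.pi ^ 2 * t ^ 2 := by
        rw [hL]; ring
      have e2 : -(saddlePhi₂ α y / (40 * Real.log y ^ 2)) = -(φ / (20 * L ^ 2) / 2) := by rw [hφ, hL]; ring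
      rw [e1, e2] at h
      exact h

/-! ### Decay in the middle range -/

/-- **Decay of `ζ(σ + it, y)/ζ(σ, y)` for `π/log y ≤ |t| ≤ y/(100 log y)`, `0 < σ ≤ 1`**: there are `c > 0`
and `y₀` with `|ζ(σ+it, y)| ≤ ζ(σ, y) exp(-c y^{1-σ}/log⁵ y)` (`SmoothZetaDecayResonance` and
`|ζ(s,y)/ζ(σ,y)| ≤ exp(-Σ p^{-σ}(1 - cos(t log p)))`). [cite: HildebrandTenenbaum1986, §3 Lemma 8 (ii)] -/
theorem exists_norm_smoothZetaC_le_exp_neg_mid :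
    ∃ c : ℝ, 0 < c ∧ ∃ y₀ : ℕ, ∀ y : ℕ, y₀ ≤ y → ∀ σ : ℝ, 0 < σ → σ ≤ 1 →
      ∀ t : ℝ, Real.pi / Real.log y ≤ |t| → |t| ≤ (y : ℝ) / (100 * Real.log y) →
        ‖smoothZetaC ((σ : ℂ) + t * I) y‖ ≤
          smoothZeta σ y * Real.exp (-(c * ((y : ℝ) ^ (1 - σ) / Real.log y ^ 5))) := by
  obtain ⟨c₁, hc₁, y₁, h₁⟩ := exists_decaySum_ge_of_le_div_log
  obtain ⟨c₂, hc₂, y₂, h₂⟩ := exists_decaySum_ge_of_pi_div_log_le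
  refine ⟨min c₁ c₂, lt_min hc₁ hc₂, max (max y₁ y₂) 3, fun y hy σ hσ0 hσ1 t ht1 ht2 => ?_⟩
  have hy₁ : y₁ ≤ y := le_trans (le_max_left _ _) (le_trans (le_max_left _ _) hy)
  have hy₂ : y₂ ≤ y := le_trans (le_max_right _ _) (le_trans (le_max_left _ _) hy)
  have hy3 : (3 : ℝ) ≤ y := by exact_mod_cast le_trans (le_max_right _ _) hy
  have hy0 : (0 : ℝ) < y := by linarith
  have hL1 : 1 ≤ Real.log y := by
    rw [Real.le_log_iff_exp_le hy0]; exact le_trans Real.exp_one_lt_d9.le (by linarith)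
  have hpow0 : 0 ≤ (y : ℝ) ^ (1 - σ) := Real.rpow_nonneg hy0.le _
  refine (norm_smoothZetaC_le_mul_exp_neg_decaySum hσ0 t y).trans
    (mul_le_mul_of_nonneg_left (Real.exp_le_exp.2 (neg_le_neg ?_)) (smoothZeta_pos hσ0).le)
  -- `min(c₁, c₂) y^{1-σ}/L⁵ ≤ decay sum`
  rcases le_or_gt |t| 3 with ht3 | ht3
  · have h := h₂ y hy₂ σ hσ0 hσ1 t ht1 ht3
    refine le_trans ?_ h
    exact mul_le_mul_of_nonneg_right (min_le_right _ _) (by positivity)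
  · have h := h₁ y hy₁ σ hσ0 hσ1 t ht3.le ht2
    refine le_trans ?_ h
    have hL5 : Real.log y ^ 3 ≤ Real.log y ^ 5 := pow_le_pow_right₀ hL1 (by norm_num)
    calc min c₁ c₂ * ((y : ℝ) ^ (1 - σ) / Real.log y ^ 5) ≤ c₁ * ((y : ℝ) ^ (1 - σ) / Real.log y ^ 5) :=
          mul_le_mul_of_nonneg_right (min_le_left _ _) (by positivity)
      _ ≤ c₁ * ((y : ℝ) ^ (1 - σ) / Real.log y ^ 3) := by
          refine mul_le_mul_of_nonneg_left ?_ hc₁.le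
          exact div_le_div_of_nonneg_left hpow0 (by positivity) hL5

/-! ### Two numerical lemmas -/

/-- `(1 + V)^{-K/4} ≤ exp(-KV/8)` for `0 ≤ V ≤ 1`, `K ≥ 0` (`log(1 + V) ≥ V/2`). [folklore] -/
theorem rpow_neg_quarter_le_exp {K V : ℝ} (hK : 0 ≤ K) (hV0 : 0 ≤ V) (hV1 : V ≤ 1) :
    (1 + V) ^ (-(K / 4)) ≤ Real.exp (-(K * V / 8)) := by
  have h1V : 0 < 1 + V := by linarith
  have hlog : V / 2 ≤ Real.log (1 + V) := by
    have h := Real.one_sub_inv_le_log_of_pos h1V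
    have h2 : V / 2 ≤ 1 - (1 + V)⁻¹ := by
      rw [show 1 - (1 + V)⁻¹ = V / (1 + V) by field_simp; ring]
      exact div_le_div_of_nonneg_left hV0 h1V (by linarith)
    linarith
  rw [Real.rpow_def_of_pos h1V]
  refine Real.exp_le_exp.2 ?_
  have := mul_le_mul_of_nonneg_left hlog (by linarith : 0 ≤ K / 4)
  nlinarith

/-- `√K ≤ 2^{K/8}` for `K ≥ 64` (`2^{K/8} = (e^{K log 2/16})² ≥ (1 + K log 2/16)²`). [folklore] -/
theorem sqrt_le_two_rpow_div_eight {K : ℝ} (hK : 64 ≤ K) : Real.sqrt K ≤ (2 : ℝ) ^ (K / 8) := by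
  set s : ℝ := Real.sqrt K with hs
  have hs0 : 0 ≤ s := Real.sqrt_nonneg K
  have hsK : s ^ 2 = K := Real.sq_sqrt (by linarith)
  have hs8 : 8 ≤ s := by
    rw [hs, show (8 : ℝ) = Real.sqrt 64 by rw [show (64 : ℝ) = 8 ^ 2 by norm_num, Real.sqrt_sq (by norm_num)]]
    exact Real.sqrt_le_sqrt hK
  have hl2 := Real.log_two_gt_d9
  have hexp : (2 : ℝ) ^ (K / 8) = Real.exp (K * Real.log 2 / 16) ^ 2 := by
    rw [← Real.exp_nat_mul, Real.rpow_def_of_pos (by norm_num)]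
    congr 1; push_cast; ring
  have hlow : 1 + K * Real.log 2 / 16 ≤ Real.exp (K * Real.log 2 / 16) := by
    have := Real.add_one_le_exp (K * Real.log 2 / 16); linarith
  have h0 : 0 ≤ 1 + K * Real.log 2 / 16 := by positivity
  have hsq : (1 + K * Real.log 2 / 16) ^ 2 ≤ Real.exp (K * Real.log 2 / 16) ^ 2 :=
    pow_le_pow_left₀ h0 hlow 2
  rw [hexp]
  refine le_trans ?_ hsq
  -- `s ≤ (1 + 0.0433 s²)²` for `s ≥ 8`
  rw [← hsK]
  have h1 : (0.0433 : ℝ) ≤ Real.log 2 / 16 := by linarith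
  have h2 : 1 + 0.0433 * s ^ 2 ≤ 1 + s ^ 2 * Real.log 2 / 16 := by nlinarith [sq_nonneg s]
  have h3 : s ≤ (1 + 0.0433 * s ^ 2) ^ 2 := by nlinarith [hs8, sq_nonneg s, mul_self_nonneg (s - 8)]
  have h4 : (0 : ℝ) ≤ 1 + 0.0433 * s ^ 2 := by positivity
  calc s ≤ (1 + 0.0433 * s ^ 2) ^ 2 := h3
    _ ≤ (1 + s ^ 2 * Real.log 2 / 16) ^ 2 := pow_le_pow_left₀ h4 h2 2

end RegimeB

end Literature.NumberTheory.Sieve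

end
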